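import Summits.HodgeConjecture.CorCM.GaloisSectionCount
import Mathlib.GroupTheory.SpecificGroups.Cyclic
import Mathlib.GroupTheory.Index
import HarnessLib

/-!
# PRIMITIVE CM TYPES EXIST: every finite group with a central involution `c` and order `≥ 14` has a CM set with trivial left stabiliser

COR-CM (cell `pub-hodgecm2`), binder seat b04 (gen 38), count-neutral own lane «Galois-CM-type classification».  KERNEL ONLY,
Mathlib + gen 31's counting file `CorCM/GaloisSectionCount` only: theorems; no definition, no named fact, no `sorry`.

WHY.  Gen 24's theorem «a totally real factor is fatal» (`Complement.exists_simple_degenerate_of_complement`: `Gal(K/ℚ) = N ⋊ Γ'`,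
`c ∈ Γ'`, `N ∉ {1, C₂, C₂², C₂³, C₄, C_p, S₃}` ⟹ BAD) needs a PRIMITIVE CM SET of `(Γ', c)` — a set `F` of representatives of the
cosets of `{1, c}` whose left stabiliser `{b : bF = F}` is trivial — i.e. a primitive CM type of the Galois CM field `K^N`.  The tree had
this only for cyclic `Γ'` (`RealFactor.exists_primitive_cm_of_cyclic`).  Here it is proved for EVERY finite group `Γ` with a central
involution `c` as soon as `(|Γ| − 2)·2^⌊|Γ|/4⌋ < 2^(|Γ|/2)`, in particular whenever `|Γ| ≥ 14`, by COUNTING: CM sets are parametrised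
by `ε : Γ/⟨c⟩ → Bool` (which point of each fibre of a fixed section is taken), `b ∉ {1, c}` stabilises the set of `ε` only if
`ε(b̄ q) = ε(q) ⊻ τ_b(q)` for all `q` — a twisted system under the fixed-point-free permutation `q ↦ b̄q` of `Γ/⟨c⟩`, with at most
`2^(|Γ|/4)` solutions (gen 31 `SectionCount.card_filter_twisted_le`) — and the union bound `SectionCount.exists_forall_violated` leaves an
`ε` violating all `|Γ| − 2` systems.  (The bound `|Γ| ≥ 14` is not sharp — `C₂, C₄, C₆, C₈, Q₈, …` have primitive CM sets — but the
Klein four-group and `(D₄, r²)` have none, so some hypothesis is needed.)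

* `mem_zpowers_iff_of_mul_self` — `⟨c⟩ = {1, c}` for an involution `c`.
* **`exists_primitive_cm_of_card_lt`** — the counting criterion; **`exists_primitive_cm_of_card_ge`** — `|Γ| ≥ 14` suffices.
* `exists_primitive_cm_subgroup_of_card_ge` — the same for a subgroup `Γ' ≤ G` with `c ∈ Γ'` central in `Γ'`, `|Γ'| ≥ 14`, as a
  `Finset G` (the format of `Complement.exists_simple_degenerate_of_complement`).

## References

* [Shimura1998] G. Shimura, *Abelian Varieties with Complex Multiplication and Modular Functions*, §8.2 Prop. 26, §8.4 (primitive CM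
  types; the counting itself is elementary).
-/

namespace Summit.HodgeConjecture.CorCM.GaloisModels.PrimitiveCount

open Finset
open Summit.HodgeConjecture.CorCM.GaloisModels.SectionCount (exists_forall_violated)

/-! ## §1 The subgroup `{1, c}` of an involution -/

section Group

variable {Γ : Type*} [Group Γ]

/-- For an involution `c` (`c·c = 1`): `b ∈ ⟨c⟩ ↔ b = 1 ∨ b = c`. [folklore] -/
theorem mem_zpowers_iff_of_mul_self {c b : Γ} (hcc : c * c = 1) : b ∈ Subgroup.zpowers c ↔ b = 1 ∨ b = c := by
  constructor
  · intro hb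
    obtain ⟨k, rfl⟩ := Subgroup.mem_zpowers_iff.1 hb
    have hc2 : c ^ (2 : ℤ) = 1 := by rw [show (2 : ℤ) = ((2 : ℕ) : ℤ) from rfl, zpow_natCast, pow_two, hcc]
    have hk : c ^ k = c ^ (k % 2) := by
      conv_lhs => rw [← Int.emod_add_mul_ediv k 2, zpow_add, zpow_mul, hc2, one_zpow, mul_one]
    rw [hk]
    rcases Int.emod_two_eq_zero_or_one k with h | h
    · left; rw [h, zpow_zero]
    · right; rw [h, zpow_one]
  · rintro (h | h) <;> rw [h]
    · exact one_mem _
    · exact Subgroup.mem_zpowers c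

/-- `⟨c⟩` is normal for a central `c`. [folklore] -/
theorem zpowers_normal_of_comm {c : Γ} (hcz : ∀ g : Γ, c * g = g * c) : (Subgroup.zpowers c).Normal := by
  refine ⟨fun y hy g => ?_⟩
  obtain ⟨k, rfl⟩ := Subgroup.mem_zpowers_iff.1 hy
  have hcomm : g * c ^ k = c ^ k * g := ((show Commute c g from hcz g).zpow_left k).symm.eq
  rw [hcomm, mul_inv_cancel_right]
  exact hy

/-- The four-case check behind the CM property of the sets `F_ε` below: `v, T ∈ {S, cS}` ⟹ (`v = T ↔ c v ≠ T`). [folklore] -/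
theorem eq_iff_mul_ne_of_two_valued {c S v T : Γ} (hne : ∀ x : Γ, x ≠ c * x) (hccs : ∀ x : Γ, c * (c * x) = x)
    (hv : v = S ∨ v = c * S) (hT : T = S ∨ T = c * S) : v = T ↔ ¬ c * v = T := by
  rcases hv with rfl | rfl <;> rcases hT with rfl | rfl
  · exact ⟨fun _ h => hne _ h.symm, fun _ => rfl⟩
  · exact ⟨fun h => absurd h (hne _), fun h => absurd rfl h⟩
  · exact ⟨fun h => absurd h.symm (hne _), fun h => absurd (hccs _) h⟩
  · exact ⟨fun _ h => hne _ (by rwa [hccs] at h), fun _ => rfl⟩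

end Group

/-! ## §2 The counting criterion -/

section Count

variable {Γ : Type*} [Group Γ] [Fintype Γ] [DecidableEq Γ]

/-- **PRIMITIVE CM SETS BY COUNTING.**  `c` a central involution (`c ≠ 1`) of the finite group `Γ`; if
`(|Γ| − 2) · 2^(⌊|Γ|/2⌋/2) < 2^(|Γ|/2)` then there is a CM set `F` (`v ∈ F ↔ c v ∉ F`) with TRIVIAL LEFT STABILISER (for every
`b ≠ 1` some `v` has `¬ (v ∈ F ↔ b v ∈ F)`) — a primitive CM type of the corresponding Galois CM field.
[cite: Shimura1998, §8.2 Prop. 26 and §8.4] -/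
theorem exists_primitive_cm_of_card_lt {c : Γ} (hcz : ∀ g : Γ, c * g = g * c) (hcc : c * c = 1) (hc1 : c ≠ 1)
    (hbig : (Fintype.card Γ - 2) * 2 ^ (Fintype.card Γ / 2 / 2) < 2 ^ (Fintype.card Γ / 2)) :
    ∃ F : Finset Γ, (∀ v, v ∈ F ↔ c * v ∉ F) ∧ ∀ b : Γ, b ≠ 1 → ∃ v, ¬ (v ∈ F ↔ b * v ∈ F) := by
  classical
  set Z : Subgroup Γ := Subgroup.zpowers c with hZ
  haveI hZn : Z.Normal := zpowers_normal_of_comm hcz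
  have hZmem : ∀ b : Γ, b ∈ Z ↔ b = 1 ∨ b = c := fun b => mem_zpowers_iff_of_mul_self hcc
  have hne : ∀ x : Γ, x ≠ c * x := fun x h => hc1 (by
    have := congrArg (· * x⁻¹) h
    simpa using this.symm)
  have hccs : ∀ x : Γ, c * (c * x) = x := fun x => by rw [← mul_assoc, hcc, one_mul]
  -- the quotient `Γ/⟨c⟩`, of order `|Γ|/2`
  have hcardZ : Nat.card Z = 2 := by
    rw [hZ, Nat.card_zpowers, orderOf_eq_prime (by rw [pow_two, hcc]) hc1]
  have hcardα : Fintype.card (Γ ⧸ Z) = Fintype.card Γ / 2 := by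
    have h := Subgroup.card_eq_card_quotient_mul_card_subgroup Z
    rw [hcardZ, Nat.card_eq_fintype_card, Nat.card_eq_fintype_card] at h
    omega
  -- the projection, a section, and its two-valuedness
  set π : Γ →* Γ ⧸ Z := QuotientGroup.mk' Z with hπ
  set s : Γ ⧸ Z → Γ := fun q => Quotient.out q with hs
  have hπs : ∀ q : Γ ⧸ Z, π (s q) = q := fun q => by
    rw [hπ, QuotientGroup.mk'_apply, hs]
    exact QuotientGroup.out_eq' q
  have hπc1 : π c = 1 := by
    rw [hπ, QuotientGroup.mk'_apply, QuotientGroup.eq_one_iff]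
    exact (hZmem c).2 (Or.inr rfl)
  have hπc : ∀ x : Γ, π (c * x) = π x := fun x => by rw [map_mul, hπc1, one_mul]
  have hπeq : ∀ a b : Γ, π a = π b → a⁻¹ * b ∈ Z := fun a b h => by
    rw [← QuotientGroup.eq_one_iff, ← QuotientGroup.mk'_apply, ← hπ, map_mul, map_inv, h, inv_mul_cancel]
  have htwo : ∀ v : Γ, v = s (π v) ∨ v = c * s (π v) := fun v => by
    rcases (hZmem _).1 (hπeq (s (π v)) v (hπs (π v))) with h | h
    · left; exact (inv_mul_eq_one.1 h).symm
    · right; rw [hcz]; exact inv_mul_eq_iff_eq_mul.1 h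
  -- the systems: `V = Γ ∖ {1, c}`, `ψ_b q = b̄ q`, `τ_b q ⟺ b s(q) = c s(b̄ q)`
  set V : Finset Γ := ((Finset.univ : Finset Γ).erase 1).erase c with hV
  have hmemV : ∀ b, b ∈ V ↔ b ≠ 1 ∧ b ≠ c := fun b => by
    rw [hV, Finset.mem_erase, Finset.mem_erase]
    simp only [Finset.mem_univ, and_true]
    tauto
  have hVcard : V.card = Fintype.card Γ - 2 := by
    have h1 : c ∈ (Finset.univ : Finset Γ).erase 1 := Finset.mem_erase.2 ⟨hc1, Finset.mem_univ _⟩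
    rw [hV, Finset.card_erase_of_mem h1, Finset.card_erase_of_mem (Finset.mem_univ _), Finset.card_univ]
    omega
  let ψ : Γ → (Γ ⧸ Z) → (Γ ⧸ Z) := fun b q => π b * q
  let τ : Γ → (Γ ⧸ Z) → Bool := fun b q => decide (b * s q = c * s (π b * q))
  have hinj : ∀ b ∈ V, Function.Injective (ψ b) := fun b _ q q' h => mul_left_cancel h
  have hfix : ∀ b ∈ V, ∀ q, ψ b q ≠ q := by
    intro b hb q h
    have hb1 : π b = 1 := by
      have : π b * q = 1 * q := by rw [one_mul]; exact h
      exact mul_right_cancel this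
    rw [hπ, QuotientGroup.mk'_apply, QuotientGroup.eq_one_iff, hZmem] at hb1
    rw [hmemV] at hb
    tauto
  have hbig' : V.card * 2 ^ (Fintype.card (Γ ⧸ Z) / 2) < 2 ^ Fintype.card (Γ ⧸ Z) := by
    rw [hVcard, hcardα]
    exact hbig
  obtain ⟨ε, hε⟩ := exists_forall_violated V ψ hinj hfix τ hbig'
  -- the CM set attached to `ε`
  set t : (Γ ⧸ Z) → Γ := fun q => cond (ε q) (c * s q) (s q) with ht
  have htq : ∀ q, t q = s q ∨ t q = c * s q := fun q => by
    change cond (ε q) (c * s q) (s q) = s q ∨ cond (ε q) (c * s q) (s q) = c * s q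
    cases ε q
    · exact Or.inl rfl
    · exact Or.inr rfl
  have hπt : ∀ q, π (t q) = q := fun q => by
    rcases htq q with h | h
    · rw [h, hπs]
    · rw [h, hπc, hπs]
  set F : Finset Γ := Finset.univ.filter fun v => v = t (π v) with hF
  have hmemF : ∀ v, v ∈ F ↔ v = t (π v) := fun v => by rw [hF, Finset.mem_filter]; simp
  refine ⟨F, fun v => ?_, fun b hb1 => ?_⟩
  · -- CM property
    rw [hmemF, hmemF, hπc]
    exact eq_iff_mul_ne_of_two_valued hne hccs (htwo v) (htq (π v))
  · -- trivial left stabiliser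
    by_cases hbc : b = c
    · subst hbc
      refine ⟨t (π 1), fun h => ?_⟩
      have h1 : t (π 1) ∈ F := by rw [hmemF, hπt]
      have h2 : b * t (π 1) ∉ F := by
        rw [hmemF, hπc, hπt]
        exact fun h' => hne _ h'.symm
      exact h2 (h.1 h1)
    have hbV : b ∈ V := (hmemV b).2 ⟨hb1, hbc⟩
    obtain ⟨z, hz⟩ := hε b hbV
    refine ⟨t z, fun h => ?_⟩
    have h1 : t z ∈ F := by rw [hmemF, hπt]
    have h2 := h.1 h1
    rw [hmemF, map_mul, hπt] at h2
    -- `b s(z) ∈ {s(b̄z), c s(b̄z)}`, and the value of `τ_b z`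
    have hb0 := htwo (b * s z)
    rw [map_mul, hπs] at hb0
    have hbc' : b * (c * s z) = c * (b * s z) := by rw [← mul_assoc, ← hcz b, mul_assoc]
    have hτT : b * s z = c * s (π b * z) → τ b z = true := fun h' => decide_eq_true h'
    have hτF : b * s z = s (π b * z) → τ b z = false := fun h' =>
      decide_eq_false fun h'' => hne _ (h'.symm.trans h'')
    revert hz h2
    change (ε (π b * z) ≠ xor (ε z) (τ b z)) →
      b * cond (ε z) (c * s z) (s z) = cond (ε (π b * z)) (c * s (π b * z)) (s (π b * z)) → False
    cases ε z <;> cases ε (π b * z) <;> intro hz h2 <;> simp only [cond_true, cond_false] at h2 <;>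
      rcases hb0 with hb0 | hb0 <;>
      first
        | exact hz (by rw [hτF hb0]; decide)
        | exact hz (by rw [hτT hb0]; decide)
        | exact hne _ (h2.symm.trans hb0)
        | exact hne _ (hb0.symm.trans h2)
        | exact hne _ (by have h3 := hbc'.symm.trans h2; rw [hb0] at h3; exact h3.symm)

/-- `(2m − 2) · 2^(m/2) < 2^m` for `m ≥ 7`. [folklore] -/
theorem two_mul_sub_two_mul_pow_lt {m : ℕ} (hm : 7 ≤ m) : (2 * m - 2) * 2 ^ (m / 2) < 2 ^ m := by
  -- `2m − 2 ≤ 4k − 2 < 2^k` with `k = m − m/2 ≥ 4`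
  have hk : ∀ k : ℕ, 4 ≤ k → 4 * k - 2 < 2 ^ k := by
    intro k hk
    induction k, hk using Nat.le_induction with
    | base => norm_num
    | succ k hk ih =>
      have : 2 ^ (k + 1) = 2 * 2 ^ k := by rw [pow_succ, mul_comm]
      omega
  have h1 : 2 * m - 2 < 2 ^ (m - m / 2) := by
    have := hk (m - m / 2) (by omega)
    omega
  calc (2 * m - 2) * 2 ^ (m / 2) < 2 ^ (m - m / 2) * 2 ^ (m / 2) :=
        Nat.mul_lt_mul_of_pos_right h1 (Nat.pow_pos two_pos)
    _ = 2 ^ m := by rw [← pow_add, Nat.sub_add_cancel (Nat.div_le_self m 2)]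

/-- **Every finite group of order `≥ 14` with a central involution `c` has a PRIMITIVE CM SET** (a CM set for `c` with trivial left
stabiliser). [cite: Shimura1998, §8.2 Prop. 26 and §8.4] -/
theorem exists_primitive_cm_of_card_ge {c : Γ} (hcz : ∀ g : Γ, c * g = g * c) (hcc : c * c = 1) (hc1 : c ≠ 1)
    (h14 : 14 ≤ Fintype.card Γ) :
    ∃ F : Finset Γ, (∀ v, v ∈ F ↔ c * v ∉ F) ∧ ∀ b : Γ, b ≠ 1 → ∃ v, ¬ (v ∈ F ↔ b * v ∈ F) := by
  refine exists_primitive_cm_of_card_lt hcz hcc hc1 ?_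
  -- `|Γ| = 2m` is even
  obtain ⟨m, hm⟩ : 2 ∣ Fintype.card Γ := by
    have h2 : orderOf c = 2 := orderOf_eq_prime (by rw [pow_two, hcc]) hc1
    rw [← h2]
    exact orderOf_dvd_card
  rw [hm, Nat.mul_div_cancel_left m two_pos]
  exact two_mul_sub_two_mul_pow_lt (by omega)

end Count

/-! ## §3 Subgroup form -/

/-- **Primitive CM sets on a subgroup**: `Γ' ≤ G` finite with `c ∈ Γ'` an involution commuting with `Γ'` and `|Γ'| ≥ 14` ⟹ a finite
set `F ⊆ G` with `v ∈ F ↔ c v ∉ F` for `v ∈ Γ'` and, for every `b ∈ Γ' ∖ 1`, some `v ∈ Γ'` with `¬ (v ∈ F ↔ b v ∈ F)` — the input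
format of `Complement.exists_simple_degenerate_of_complement`. [cite: Shimura1998, §8.2 Prop. 26 and §8.4] -/
theorem exists_primitive_cm_subgroup_of_card_ge {G : Type*} [Group G] [Finite G] [DecidableEq G] (Γ' : Subgroup G) {c : G}
    (hc : c ∈ Γ') (hcz : ∀ g ∈ Γ', c * g = g * c) (hcc : c * c = 1) (hc1 : c ≠ 1) (h14 : 14 ≤ Nat.card Γ') :
    ∃ F : Finset G, (∀ v ∈ Γ', v ∈ F ↔ c * v ∉ F) ∧ ∀ b ∈ Γ', b ≠ 1 → ∃ v ∈ Γ', ¬ (v ∈ F ↔ b * v ∈ F) := by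
  classical
  haveI : Fintype Γ' := Fintype.ofFinite Γ'
  have hcz' : ∀ g : Γ', (⟨c, hc⟩ : Γ') * g = g * ⟨c, hc⟩ := fun g => Subtype.ext (hcz g g.2)
  have hcc' : (⟨c, hc⟩ : Γ') * ⟨c, hc⟩ = 1 := Subtype.ext hcc
  have hc1' : (⟨c, hc⟩ : Γ') ≠ 1 := fun h => hc1 (congrArg Subtype.val h)
  have h14' : 14 ≤ Fintype.card Γ' := by rwa [← Nat.card_eq_fintype_card]
  obtain ⟨F₀, hcm, hprim⟩ := exists_primitive_cm_of_card_ge hcz' hcc' hc1' h14'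
  have hmem : ∀ w : Γ', (w : G) ∈ F₀.map (Function.Embedding.subtype _) ↔ w ∈ F₀ := fun w => by
    rw [Finset.mem_map]
    exact ⟨fun ⟨w', hw', hwv⟩ => by rw [← Subtype.ext hwv]; exact hw', fun h => ⟨w, h, rfl⟩⟩
  refine ⟨F₀.map (Function.Embedding.subtype _), fun v hv => ?_, fun b hb hb1 => ?_⟩
  · have e1 := hmem ⟨v, hv⟩
    have e2 := hmem (⟨c, hc⟩ * ⟨v, hv⟩)
    simp only [Subgroup.coe_mul] at e1 e2
    rw [e1, e2]
    exact hcm ⟨v, hv⟩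
  · obtain ⟨w, hw⟩ := hprim ⟨b, hb⟩ (fun h => hb1 (congrArg Subtype.val h))
    refine ⟨w.1, w.2, fun h => hw ?_⟩
    have e1 := hmem w
    have e2 := hmem (⟨b, hb⟩ * w)
    simp only [Subgroup.coe_mul] at e2
    rw [e1, e2] at h
    exact h

end Summit.HodgeConjecture.CorCM.GaloisModels.PrimitiveCount
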